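import Summits.QuantumFields.YangMills.Theorems.PencilRigidityWeakCouplingHypercubicLimitReflectedPairCylinder
import Summits.QuantumFields.YangMills.Theorems.PencilRigidityWeakCouplingHypercubicLimitStubWilsonStepReversal
import Summits.QuantumFields.YangMills.Theorems.PencilRigidityWeakCouplingHypercubicLimitStubBlockReversalTranspose
import Literature.Analysis.OperatorTheory.SlabFibreContractionSucc
import HarnessLib

/-!
# Reflected slab pairs in transfer form (line `Sketch` of crux `PencilRigidity.WeakCouplingHypercubicLimit`,
# stmt-QuantumFields-16120)

The Wilson-theory half of `stub_rpSpectralOfColdPressure`: for a bounded measurable functional `Y` of the time slab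
`[1, r+2]` of `ℤ⁴`, its link reflection `ΘY = Y ∘ lift ∘ Θ_T` (`GaugeConfig.timeReflect`, `θ t = 1 − t`) and its time
translate `Y_n = Y ∘ τ_n ∘ lift`, the three torus expectations `⟨ΘY · Y_n⟩`, `⟨ΘY · Y⟩`, `⟨Y⟩` of Wilson's theory on
`(ℤ/(2S+1))⁴` (`2S+1 = 2r + n + b' + 5`) are ratios of cyclic integrals of the slice kernel `wilsonSliceKernel r.ρ β` with
ONE contracted block kernel `X_b` (of `Y`) and its TRANSPOSE (of `ΘY`): slicing (T1 `stub_timeSlicing`), the cylinder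
property of `Y` in sliced coordinates, a rotation of the time cycle, the gap-`(a+1)` two-block contraction
`slab_cyclic_two_succ`, and the transpose identity for the reflected block (`stub_blockReversalTranspose` with the
time-reversal symmetry `stub_wilsonStepReversal` of the one-step Boltzmann factor).  `X_b` is jointly strongly
measurable, bounded by `sup |Y|`, and dominated by `sup |Y|` times the `(r+1)`-step path weight of the slice kernel.

References: K. Osterwalder, E. Seiler, Ann. Phys. 110 (1978) §§2–3; E. Seiler, LNP 159 (1982) Ch. 2. [folklore]
-/

noncomputable section

open scoped BigOperators Topology
open MeasureTheory Filter
open Literature.MathematicalPhysics.QuantumFieldTheory Literature.MathematicalPhysics.QuantumLattice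
open Literature.Analysis.OperatorTheory

namespace Summit.QuantumFields.YangMills.Theorems.WeakCouplingHypercubicLimit.TraceNormColdPressure

/-- **Reflected slab pairs in transfer form.**  See the module docstring: the torus expectations
`⟨ΘY · Y_n⟩`, `⟨ΘY · Y⟩` and `⟨Y⟩` as ratios of the two-insertion (transposed kernel at bond `0`, direct kernel at bond
`n+2`, resp. `2`), one-insertion and vacuum cyclic integrals of `wilsonSliceKernel r.ρ β`, for ONE contracted block
kernel `X_b` which is jointly strongly measurable, bounded by `B = sup |Y|` and dominated by `B` times the `(r+1)`-step
path weight. [folklore] -/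
theorem reflectedPair_transferForm :
    ∀ (G : Type) [Group G] [TopologicalSpace G] [IsTopologicalGroup G] [CompactSpace G]
      [MeasurableSpace G] [BorelSpace G] (r : LatticeRep G) (β : ℝ), 0 ≤ β →
    ∀ (S rr n b' : ℕ), 2 * S + 1 = 2 * rr + n + b' + 4 + 1 →
    ∀ (Y : LGConfig 4 G → ℝ) (B : ℝ), Measurable Y → (∀ U, |Y U| ≤ B) →
      DependsOn Y {e : Literature.MathematicalPhysics.QuantumLattice.ZdEdge 4 |
        1 ≤ e.1 0 ∧ e.1 0 + (if e.2 = 0 then 1 else 0) ≤ ((rr + 2 : ℕ) : ℤ)} →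
    ∃ Xb : GaugeConfig 3 (2 * S + 1) G → GaugeConfig 3 (2 * S + 1) G → ℝ,
      StronglyMeasurable (Function.uncurry Xb) ∧ (∀ u u', |Xb u u'| ≤ B) ∧
      (∀ u u', |Xb u u'| ≤ B * (∫ v : Fin rr → GaugeConfig 3 (2 * S + 1) G, ∏ i : Fin (rr + 1),
        wilsonSliceKernel r.ρ β ((Fin.cons u (Fin.snoc v u') : Fin (rr + 2) → GaugeConfig 3 (2 * S + 1) G) (Fin.castSucc i))
          ((Fin.cons u (Fin.snoc v u') : Fin (rr + 2) → GaugeConfig 3 (2 * S + 1) G) (Fin.succ i))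
        ∂(Measure.pi fun _ => Measure.pi fun _ : Edge 3 (2 * S + 1) => haarProbability G))) ∧
      (∫ U, Y (torusLift (2 * S + 1) (GaugeConfig.timeReflect U)) *
            Y (configShift (-Pi.single 0 (n : ℤ)) (torusLift (2 * S + 1) U))
          ∂(wilsonMeasure r.ρ β : Measure (GaugeConfig 4 (2 * S + 1) G))) =
        (∫ V : Fin (1 + (n + 1 + (b' + 1 + 1)) + 1) → GaugeConfig 3 (2 * S + 1) G,
            ∏ t : Fin (1 + (n + 1 + (b' + 1 + 1)) + 1),
              (fun s : ℕ => if s = 0 then (fun u u' => Xb u' u) else if s = n + 1 + 1 then Xb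
                else fun x x' => wilsonSliceKernel r.ρ β x x') (t : ℕ) (V t) (V (t + 1))
          ∂(Measure.pi fun _ => Measure.pi fun _ : Edge 3 (2 * S + 1) => haarProbability G)) /
        (∫ V : Fin (2 * rr + n + b' + 3 + 2) → GaugeConfig 3 (2 * S + 1) G, ∏ t, wilsonSliceKernel r.ρ β (V t) (V (t + 1))
          ∂(Measure.pi fun _ => Measure.pi fun _ : Edge 3 (2 * S + 1) => haarProbability G)) ∧
      (∫ U, Y (torusLift (2 * S + 1) (GaugeConfig.timeReflect U)) * Y (torusLift (2 * S + 1) U)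
          ∂(wilsonMeasure r.ρ β : Measure (GaugeConfig 4 (2 * S + 1) G))) =
        (∫ V : Fin (1 + (0 + 1 + ((n + b') + 1 + 1)) + 1) → GaugeConfig 3 (2 * S + 1) G,
            ∏ t : Fin (1 + (0 + 1 + ((n + b') + 1 + 1)) + 1),
              (fun s : ℕ => if s = 0 then (fun u u' => Xb u' u) else if s = 0 + 1 + 1 then Xb
                else fun x x' => wilsonSliceKernel r.ρ β x x') (t : ℕ) (V t) (V (t + 1))
          ∂(Measure.pi fun _ => Measure.pi fun _ : Edge 3 (2 * S + 1) => haarProbability G)) /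
        (∫ V : Fin (2 * rr + n + b' + 3 + 2) → GaugeConfig 3 (2 * S + 1) G, ∏ t, wilsonSliceKernel r.ρ β (V t) (V (t + 1))
          ∂(Measure.pi fun _ => Measure.pi fun _ : Edge 3 (2 * S + 1) => haarProbability G)) ∧
      (∫ U, Y (torusLift (2 * S + 1) U) ∂(wilsonMeasure r.ρ β : Measure (GaugeConfig 4 (2 * S + 1) G))) =
        (∫ V : Fin (1 + (rr + n + b' + 2 + 1) + 1) → GaugeConfig 3 (2 * S + 1) G, Xb (V 0) (V 1) *
            ∏ t : Fin (1 + (rr + n + b' + 2 + 1)), wilsonSliceKernel r.ρ β (V t.succ) (V (t.succ + 1))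
          ∂(Measure.pi fun _ => Measure.pi fun _ : Edge 3 (2 * S + 1) => haarProbability G)) /
        (∫ V : Fin (2 * rr + n + b' + 3 + 2) → GaugeConfig 3 (2 * S + 1) G, ∏ t, wilsonSliceKernel r.ρ β (V t) (V (t + 1))
          ∂(Measure.pi fun _ => Measure.pi fun _ : Edge 3 (2 * S + 1) => haarProbability G)) := by
  intro G _ _ _ _ _ _ r β hβ S rr n b' hN Y B hYm hYb hYd
  haveI : SecondCountableTopology G :=
    (r.continuous.isClosedEmbedding r.injective).isEmbedding.secondCountableTopology
  -- the assembling map, rotations of the time cycle, extension of a window, the block observable of `Y`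
  obtain ⟨asm, hasm_def⟩ : ∃ asm : (ZMod (2 * S + 1) → GaugeConfig 3 (2 * S + 1) G) × (ZMod (2 * S + 1) → Site 3 (2 * S + 1) → G) →
      GaugeConfig 4 (2 * S + 1) G, asm = fun p => fun e : Edge 4 (2 * S + 1) =>
        (Fin.cons (p.2 (e.1 0) (Fin.tail e.1)) (fun i : Fin 3 => p.1 (e.1 0) (Fin.tail e.1, i)) : Fin 4 → G) e.2 := ⟨_, rfl⟩
  obtain ⟨rot, hrot_def⟩ : ∃ rot : ZMod (2 * S + 1) →
      (ZMod (2 * S + 1) → GaugeConfig 3 (2 * S + 1) G) × (ZMod (2 * S + 1) → Site 3 (2 * S + 1) → G) →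
      (ZMod (2 * S + 1) → GaugeConfig 3 (2 * S + 1) G) × (ZMod (2 * S + 1) → Site 3 (2 * S + 1) → G),
    rot = fun c₀ p => (fun τ => p.1 (τ + c₀), fun τ => p.2 (τ + c₀)) := ⟨_, rfl⟩
  -- the block observable of `Y` and the cylinder identities (translates, reflection) in sliced coordinates
  obtain ⟨blk, hblk_meas, hblkB, hcylS', hcylR'⟩ := reflectedPair_cylinder G S rr (by omega) Y B hYm hYb hYd
  have hcylS : ∀ (m : ℕ) (q : (ZMod (2 * S + 1) → GaugeConfig 3 (2 * S + 1) G) × (ZMod (2 * S + 1) → Site 3 (2 * S + 1) → G)),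
      Y (configShift (-Pi.single 0 (m : ℤ)) (torusLift (2 * S + 1) (asm q))) =
        blk (fun i : Fin (rr + 2) => q.1 ((m + 1 + (i : ℕ) : ℕ) : ZMod (2 * S + 1)))
          (fun i : Fin (rr + 1) => q.2 ((m + 1 + (i : ℕ) : ℕ) : ZMod (2 * S + 1))) := fun m q => by
    rw [hasm_def]; exact hcylS' m q
  have hcylRraw : ∀ q : (ZMod (2 * S + 1) → GaugeConfig 3 (2 * S + 1) G) × (ZMod (2 * S + 1) → Site 3 (2 * S + 1) → G),
      Y (torusLift (2 * S + 1) (GaugeConfig.timeReflect (asm q))) =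
        blk (fun i : Fin (rr + 2) => q.1 (-((i : ℕ) : ZMod (2 * S + 1))))
          (fun j : Fin (rr + 1) => fun y => (q.2 (-(((j : ℕ) + 1 : ℕ) : ZMod (2 * S + 1))) y)⁻¹) := fun q => by
    rw [hasm_def]; exact hcylR' q
  -- the reversed block observable (the block of `ΘY`)
  obtain ⟨blkR, hblkR_def⟩ : ∃ blkR : (Fin (rr + 2) → GaugeConfig 3 (2 * S + 1) G) → (Fin (rr + 1) → Site 3 (2 * S + 1) → G) → ℝ,
    blkR = fun W δs => blk (fun i => W (Fin.rev i)) (fun i => fun x => ((δs (Fin.rev i)) x)⁻¹) := ⟨_, rfl⟩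
  -- slice data (T2), reversal (R4)
  obtain ⟨hk_meas, hk_le, hs_meas, hs_le, hK_sm, hK_symm, hK_bd, hK_pt⟩ := stub_sliceKernel G r (2 * S + 1) β hβ
  obtain ⟨hrev, hinv_meas, hinv_mp⟩ := stub_wilsonStepReversal G r (2 * S + 1)
  have hrevW : Measurable fun W : Fin (rr + 2) → GaugeConfig 3 (2 * S + 1) G => fun i => W (Fin.rev i) :=
    measurable_pi_lambda _ fun i => measurable_pi_apply _
  have hrevδ : Measurable fun δs : Fin (rr + 1) → Site 3 (2 * S + 1) → G => fun i => fun x => ((δs (Fin.rev i)) x)⁻¹ :=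
    measurable_pi_lambda _ fun i => hinv_meas.comp (measurable_pi_apply _)
  have hblkR_meas : Measurable fun q : (Fin (rr + 2) → GaugeConfig 3 (2 * S + 1) G) × (Fin (rr + 1) → Site 3 (2 * S + 1) → G) =>
      blkR q.1 q.2 := by
    rw [hblkR_def]
    exact hblk_meas.comp ((hrevW.comp measurable_fst).prodMk (hrevδ.comp measurable_snd))
  have hblkRB : ∀ W γs, |blkR W γs| ≤ B := fun W γs => by rw [hblkR_def]; exact hblkB _ _
  -- the rotation placing the reflected block at the sites `0 … rr+1`
  set c₀ : ZMod (2 * S + 1) := -((rr + 1 : ℕ) : ZMod (2 * S + 1)) with hc₀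
  have hrev2 : ∀ i : Fin (rr + 2), (((Fin.rev i : Fin (rr + 2)) : ℕ) : ZMod (2 * S + 1)) + c₀ = -((i : ℕ) : ZMod (2 * S + 1)) := by
    intro i
    have hi := i.isLt
    rw [Fin.val_rev, hc₀, Nat.cast_sub (by omega)]
    push_cast
    ring_nf
  have hrev1 : ∀ j : Fin (rr + 1), (((Fin.rev j : Fin (rr + 1)) : ℕ) : ZMod (2 * S + 1)) + c₀ = -(((j : ℕ) + 1 : ℕ) : ZMod (2 * S + 1)) := by
    intro j
    have hj := j.isLt
    rw [Fin.val_rev, hc₀, Nat.cast_sub (by omega)]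
    push_cast
    ring_nf
  -- the reflected functional in the rotated coordinates: the REVERSED block at the sites `0 … rr+1`
  have hcylR : ∀ q : (ZMod (2 * S + 1) → GaugeConfig 3 (2 * S + 1) G) × (ZMod (2 * S + 1) → Site 3 (2 * S + 1) → G),
      Y (torusLift (2 * S + 1) (GaugeConfig.timeReflect (asm q))) =
        blkR (fun i : Fin (rr + 2) => (rot c₀ q).1 ((i : ℕ) : ZMod (2 * S + 1)))
          (fun i : Fin (rr + 1) => (rot c₀ q).2 ((i : ℕ) : ZMod (2 * S + 1))) := by
    intro q
    rw [hcylRraw q, hblkR_def, hrot_def]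
    dsimp only
    simp only [hrev2, hrev1]
  -- translates of `Y` in the rotated coordinates
  have hcylT : ∀ (a : ℕ) (q : (ZMod (2 * S + 1) → GaugeConfig 3 (2 * S + 1) G) × (ZMod (2 * S + 1) → Site 3 (2 * S + 1) → G)),
      Y (configShift (-Pi.single 0 (a : ℤ)) (torusLift (2 * S + 1) (asm q))) =
        blk (fun i : Fin (rr + 2) => (rot c₀ q).1 ((rr + a + 2 + (i : ℕ) : ℕ) : ZMod (2 * S + 1)))
          (fun i : Fin (rr + 1) => (rot c₀ q).2 ((rr + a + 2 + (i : ℕ) : ℕ) : ZMod (2 * S + 1))) := by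
    intro a q
    rw [hcylS a q, hrot_def]
    have hidx : ∀ i : ℕ, ((rr + a + 2 + i : ℕ) : ZMod (2 * S + 1)) + c₀ = ((a + 1 + i : ℕ) : ZMod (2 * S + 1)) := by
      intro i; rw [hc₀]; push_cast; ring
    simp only [hidx]
  have hshift0 : ∀ V : LGConfig 4 G, configShift (0 : Literature.Probability.LatticeModels.Site 4) V = V :=
    fun V => by funext e; rw [configShift_apply, sub_zero]
  have hcyl1 : ∀ q : (ZMod (2 * S + 1) → GaugeConfig 3 (2 * S + 1) G) × (ZMod (2 * S + 1) → Site 3 (2 * S + 1) → G),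
      Y (torusLift (2 * S + 1) (asm q)) =
        blk (fun i : Fin (rr + 2) => (rot 1 q).1 ((i : ℕ) : ZMod (2 * S + 1)))
          (fun i : Fin (rr + 1) => (rot 1 q).2 ((i : ℕ) : ZMod (2 * S + 1))) := by
    intro q
    have h := hcylS 0 q
    simp only [Nat.cast_zero, Pi.single_zero, neg_zero, hshift0] at h
    rw [h, hrot_def]
    have hidx : ∀ i : ℕ, ((0 + 1 + i : ℕ) : ZMod (2 * S + 1)) = ((i : ℕ) : ZMod (2 * S + 1)) + 1 := by
      intro i; push_cast; ring
    simp only [hidx]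
  -- the one-step Boltzmann factor `c`, its reversal symmetry, and the fibre-averaged kernel
  have hc_meas : Measurable fun q : GaugeConfig 3 (2 * S + 1) G × (Site 3 (2 * S + 1) → G) × GaugeConfig 3 (2 * S + 1) G =>
      Real.exp (-(β * wilsonAction r.ρ q.1 / 2)) * Real.exp (-(β * sliceTemporalAction r.ρ q.1 q.2.1 q.2.2)) * Real.exp (-(β * wilsonAction r.ρ q.2.2 / 2)) :=
    ((hs_meas.comp measurable_fst).mul hk_meas).mul (hs_meas.comp (measurable_snd.comp measurable_snd))
  have hc_bd : ∀ (x : GaugeConfig 3 (2 * S + 1) G) (γ : Site 3 (2 * S + 1) → G) (x' : GaugeConfig 3 (2 * S + 1) G),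
      0 ≤ Real.exp (-(β * wilsonAction r.ρ x / 2)) * Real.exp (-(β * sliceTemporalAction r.ρ x γ x')) * Real.exp (-(β * wilsonAction r.ρ x' / 2)) ∧
        Real.exp (-(β * wilsonAction r.ρ x / 2)) * Real.exp (-(β * sliceTemporalAction r.ρ x γ x')) * Real.exp (-(β * wilsonAction r.ρ x' / 2)) ≤ 1 := fun x γ x' =>
    ⟨by positivity, mul_le_one₀ (mul_le_one₀ (hs_le x) (Real.exp_pos _).le (hk_le x γ x')) (Real.exp_pos _).le (hs_le x')⟩
  have hc_rev : ∀ (x : GaugeConfig 3 (2 * S + 1) G) (γ : Site 3 (2 * S + 1) → G) (x' : GaugeConfig 3 (2 * S + 1) G),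
      Real.exp (-(β * wilsonAction r.ρ x / 2)) * Real.exp (-(β * sliceTemporalAction r.ρ x ((fun g : Site 3 (2 * S + 1) → G => fun y => (g y)⁻¹) γ) x')) * Real.exp (-(β * wilsonAction r.ρ x' / 2)) =
      Real.exp (-(β * wilsonAction r.ρ x' / 2)) * Real.exp (-(β * sliceTemporalAction r.ρ x' γ x)) * Real.exp (-(β * wilsonAction r.ρ x / 2)) := by
    intro x γ x'
    dsimp only
    rw [hrev x x' γ]
    ring
  have hKc : ∀ x x' : GaugeConfig 3 (2 * S + 1) G,
      ∫ γ, Real.exp (-(β * wilsonAction r.ρ x / 2)) * Real.exp (-(β * sliceTemporalAction r.ρ x γ x')) *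
          Real.exp (-(β * wilsonAction r.ρ x' / 2)) ∂(Measure.pi fun _ : Site 3 (2 * S + 1) => haarProbability G) = wilsonSliceKernel r.ρ β x x' := by
    intro x x'
    unfold wilsonSliceKernel
    rw [integral_mul_const, integral_const_mul]
  -- the contracted block kernel of `Y` and its properties
  obtain ⟨Xb, hXb_def⟩ : ∃ Xb : GaugeConfig 3 (2 * S + 1) G → GaugeConfig 3 (2 * S + 1) G → ℝ, Xb = fun u u' =>
      ∫ v : Fin rr → GaugeConfig 3 (2 * S + 1) G, ∫ γs : Fin (rr + 1) → Site 3 (2 * S + 1) → G,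
        blk (Fin.cons u (Fin.snoc v u')) γs * ∏ i : Fin (rr + 1),
          (Real.exp (-(β * wilsonAction r.ρ ((Fin.cons u (Fin.snoc v u') : Fin (rr + 2) → GaugeConfig 3 (2 * S + 1) G) (Fin.castSucc i)) / 2)) *
            Real.exp (-(β * sliceTemporalAction r.ρ ((Fin.cons u (Fin.snoc v u') : Fin (rr + 2) → GaugeConfig 3 (2 * S + 1) G) (Fin.castSucc i)) (γs i)
              ((Fin.cons u (Fin.snoc v u') : Fin (rr + 2) → GaugeConfig 3 (2 * S + 1) G) (Fin.succ i)))) *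
            Real.exp (-(β * wilsonAction r.ρ ((Fin.cons u (Fin.snoc v u') : Fin (rr + 2) → GaugeConfig 3 (2 * S + 1) G) (Fin.succ i)) / 2)))
        ∂(Measure.pi fun _ => Measure.pi fun _ : Site 3 (2 * S + 1) => haarProbability G)
        ∂(Measure.pi fun _ => Measure.pi fun _ : Edge 3 (2 * S + 1) => haarProbability G) := ⟨_, rfl⟩
  have hXb_sm : StronglyMeasurable (Function.uncurry Xb) := by
    rw [hXb_def]
    exact slab_blockKernel_stronglyMeasurable (μ := Measure.pi fun _ : Edge 3 (2 * S + 1) => haarProbability G)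
      (ν := Measure.pi fun _ : Site 3 (2 * S + 1) => haarProbability G)
      (c := fun x γ x' => Real.exp (-(β * wilsonAction r.ρ x / 2)) * Real.exp (-(β * sliceTemporalAction r.ρ x γ x')) * Real.exp (-(β * wilsonAction r.ρ x' / 2)))
      hc_meas hblk_meas
  have hXb_dom : ∀ u u', |Xb u u'| ≤ B * (∫ v : Fin rr → GaugeConfig 3 (2 * S + 1) G, ∏ i : Fin (rr + 1),
        wilsonSliceKernel r.ρ β ((Fin.cons u (Fin.snoc v u') : Fin (rr + 2) → GaugeConfig 3 (2 * S + 1) G) (Fin.castSucc i))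
          ((Fin.cons u (Fin.snoc v u') : Fin (rr + 2) → GaugeConfig 3 (2 * S + 1) G) (Fin.succ i))
        ∂(Measure.pi fun _ => Measure.pi fun _ : Edge 3 (2 * S + 1) => haarProbability G)) := by
    intro u u'
    have h := slab_blockKernel_abs_le (μ := Measure.pi fun _ : Edge 3 (2 * S + 1) => haarProbability G)
      (ν := Measure.pi fun _ : Site 3 (2 * S + 1) => haarProbability G) (α := blk)
      (c := fun x γ x' => Real.exp (-(β * wilsonAction r.ρ x / 2)) * Real.exp (-(β * sliceTemporalAction r.ρ x γ x')) * Real.exp (-(β * wilsonAction r.ρ x' / 2)))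
      hc_meas hc_bd hblkB u u'
    rw [hXb_def]
    simp only [hKc] at h
    exact h
  have hXb_bd : ∀ u u', |Xb u u'| ≤ B := by
    intro u u'
    have h := slab_blockKernel_abs_le' (μ := Measure.pi fun _ : Edge 3 (2 * S + 1) => haarProbability G)
      (ν := Measure.pi fun _ : Site 3 (2 * S + 1) => haarProbability G) (α := blk)
      (c := fun x γ x' => Real.exp (-(β * wilsonAction r.ρ x / 2)) * Real.exp (-(β * sliceTemporalAction r.ρ x γ x')) * Real.exp (-(β * wilsonAction r.ρ x' / 2)))
      hc_meas hc_bd hblkB u u'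
    rw [hXb_def]
    simpa using h
  -- the reflected block kernel is the transpose (R3 + R4)
  have hXbR : (fun u u' : GaugeConfig 3 (2 * S + 1) G =>
      ∫ v : Fin rr → GaugeConfig 3 (2 * S + 1) G, ∫ γs : Fin (rr + 1) → Site 3 (2 * S + 1) → G,
        blkR (Fin.cons u (Fin.snoc v u')) γs * ∏ i : Fin (rr + 1),
          (Real.exp (-(β * wilsonAction r.ρ ((Fin.cons u (Fin.snoc v u') : Fin (rr + 2) → GaugeConfig 3 (2 * S + 1) G) (Fin.castSucc i)) / 2)) *
            Real.exp (-(β * sliceTemporalAction r.ρ ((Fin.cons u (Fin.snoc v u') : Fin (rr + 2) → GaugeConfig 3 (2 * S + 1) G) (Fin.castSucc i)) (γs i)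
              ((Fin.cons u (Fin.snoc v u') : Fin (rr + 2) → GaugeConfig 3 (2 * S + 1) G) (Fin.succ i)))) *
            Real.exp (-(β * wilsonAction r.ρ ((Fin.cons u (Fin.snoc v u') : Fin (rr + 2) → GaugeConfig 3 (2 * S + 1) G) (Fin.succ i)) / 2)))
        ∂(Measure.pi fun _ => Measure.pi fun _ : Site 3 (2 * S + 1) => haarProbability G)
        ∂(Measure.pi fun _ => Measure.pi fun _ : Edge 3 (2 * S + 1) => haarProbability G)) = fun u u' => Xb u' u := by
    funext u u'
    have h := stub_blockReversalTranspose (GaugeConfig 3 (2 * S + 1) G) (Site 3 (2 * S + 1) → G)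
      (Measure.pi fun _ : Edge 3 (2 * S + 1) => haarProbability G) (Measure.pi fun _ : Site 3 (2 * S + 1) => haarProbability G)
      (fun x γ x' => Real.exp (-(β * wilsonAction r.ρ x / 2)) * Real.exp (-(β * sliceTemporalAction r.ρ x γ x')) * Real.exp (-(β * wilsonAction r.ρ x' / 2)))
      1 (fun g : Site 3 (2 * S + 1) → G => fun y => (g y)⁻¹) hc_meas hc_bd hinv_meas hinv_mp
      (fun g => by funext y; exact inv_inv (g y)) hc_rev rr blk B hblk_meas hblkB u u'
    rw [hblkR_def, hXb_def]
    exact h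
  -- the expectation as a ratio of sliced integrals (`wilsonExpectation_sliced`)
  have hE : ∀ Φ : GaugeConfig 4 (2 * S + 1) G → ℝ, Measurable Φ →
      ∫ U, Φ U ∂(wilsonMeasure r.ρ β) = (∫ p, Φ (asm p) * ∏ t : ZMod (2 * S + 1), (Real.exp (-(β * wilsonAction r.ρ (p.1 t) / 2)) *
            Real.exp (-(β * sliceTemporalAction r.ρ (p.1 t) (p.2 t) (p.1 (t + 1)))) * Real.exp (-(β * wilsonAction r.ρ (p.1 (t + 1)) / 2)))
          ∂((Measure.pi fun _ : ZMod (2 * S + 1) => Measure.pi fun _ : Edge 3 (2 * S + 1) => haarProbability G).prod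
            (Measure.pi fun _ : ZMod (2 * S + 1) => Measure.pi fun _ : Site 3 (2 * S + 1) => haarProbability G))) / ∫ p, ∏ t : ZMod (2 * S + 1),
          (Real.exp (-(β * wilsonAction r.ρ (p.1 t) / 2)) * Real.exp (-(β * sliceTemporalAction r.ρ (p.1 t) (p.2 t) (p.1 (t + 1)))) * Real.exp (-(β * wilsonAction r.ρ (p.1 (t + 1)) / 2)))
          ∂((Measure.pi fun _ : ZMod (2 * S + 1) => Measure.pi fun _ : Edge 3 (2 * S + 1) => haarProbability G).prod
            (Measure.pi fun _ : ZMod (2 * S + 1) => Measure.pi fun _ : Site 3 (2 * S + 1) => haarProbability G)) := by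
    intro Φ hΦ
    rw [hasm_def]
    exact wilsonExpectation_sliced G r β S Φ hΦ
  -- measurability of the observables on the torus
  have hmY : Measurable fun U : GaugeConfig 4 (2 * S + 1) G => Y (torusLift (2 * S + 1) U) :=
    hYm.comp (measurable_torusLift _)
  have hmΘY : Measurable fun U : GaugeConfig 4 (2 * S + 1) G => Y (torusLift (2 * S + 1) (GaugeConfig.timeReflect U)) :=
    hYm.comp ((measurable_torusLift _).comp (by
      refine measurable_pi_lambda _ fun e => ?_
      unfold GaugeConfig.timeReflect
      split_ifs
      · exact (measurable_pi_apply _).inv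
      · exact measurable_pi_apply _))
  have hmYn : ∀ a : ℕ, Measurable fun U : GaugeConfig 4 (2 * S + 1) G =>
      Y (configShift (-Pi.single 0 (a : ℤ)) (torusLift (2 * S + 1) U)) := fun a =>
    hYm.comp ((configShift _).measurable.comp (measurable_torusLift _))
  -- rotations of the time cycle
  have hrotInt : ∀ (c₁ : ZMod (2 * S + 1))
      (F : (ZMod (2 * S + 1) → GaugeConfig 3 (2 * S + 1) G) × (ZMod (2 * S + 1) → Site 3 (2 * S + 1) → G) → ℝ),
      ∫ q, F (rot c₁ q) ∂((Measure.pi fun _ : ZMod (2 * S + 1) => Measure.pi fun _ : Edge 3 (2 * S + 1) => haarProbability G).prod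
            (Measure.pi fun _ : ZMod (2 * S + 1) => Measure.pi fun _ : Site 3 (2 * S + 1) => haarProbability G)) =
        ∫ p, F p ∂((Measure.pi fun _ : ZMod (2 * S + 1) => Measure.pi fun _ : Edge 3 (2 * S + 1) => haarProbability G).prod
            (Measure.pi fun _ : ZMod (2 * S + 1) => Measure.pi fun _ : Site 3 (2 * S + 1) => haarProbability G)) :=
    fun c₁ F => by rw [hrot_def]; exact integral_rotate_cycle _ _ c₁ F
  have hprod_rot : ∀ (c₁ : ZMod (2 * S + 1))
      (q : (ZMod (2 * S + 1) → GaugeConfig 3 (2 * S + 1) G) × (ZMod (2 * S + 1) → Site 3 (2 * S + 1) → G)),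
      ∏ t : ZMod (2 * S + 1), (Real.exp (-(β * wilsonAction r.ρ ((rot c₁ q).1 t) / 2)) * Real.exp (-(β * sliceTemporalAction r.ρ ((rot c₁ q).1 t) ((rot c₁ q).2 t) ((rot c₁ q).1 (t + 1)))) *
            Real.exp (-(β * wilsonAction r.ρ ((rot c₁ q).1 (t + 1)) / 2))) = ∏ t : ZMod (2 * S + 1), (Real.exp (-(β * wilsonAction r.ρ (q.1 t) / 2)) *
            Real.exp (-(β * sliceTemporalAction r.ρ (q.1 t) (q.2 t) (q.1 (t + 1)))) * Real.exp (-(β * wilsonAction r.ρ (q.1 (t + 1)) / 2))) := fun c₁ q => by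
    rw [hrot_def]
    exact prod_rotate_cycle (fun x y x' => Real.exp (-(β * wilsonAction r.ρ x / 2)) *
      Real.exp (-(β * sliceTemporalAction r.ρ x y x')) * Real.exp (-(β * wilsonAction r.ρ x' / 2))) c₁ q
  -- the vacuum cycle (slab_cyclic_zero)
  have h0 := slab_cyclic_zero (μ := Measure.pi fun _ : Edge 3 (2 * S + 1) => haarProbability G)
    (ν := Measure.pi fun _ : Site 3 (2 * S + 1) => haarProbability G)
    (c := fun x γ x' => Real.exp (-(β * wilsonAction r.ρ x / 2)) * Real.exp (-(β * sliceTemporalAction r.ρ x γ x')) * Real.exp (-(β * wilsonAction r.ρ x' / 2)))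
    hc_meas hc_bd (N := 2 * S + 1) (k := 2 * rr + n + b' + 3 + 1) (by omega)
  simp only [hKc] at h0
  -- the one-point cycle (slab_cyclic_one, block of `Y` at the sites `0 … rr+1` after rotating by `1`)
  have h1 := slab_cyclic_one (μ := Measure.pi fun _ : Edge 3 (2 * S + 1) => haarProbability G)
    (ν := Measure.pi fun _ : Site 3 (2 * S + 1) => haarProbability G)
    (c := fun x γ x' => Real.exp (-(β * wilsonAction r.ρ x / 2)) * Real.exp (-(β * sliceTemporalAction r.ρ x γ x')) * Real.exp (-(β * wilsonAction r.ρ x' / 2)))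
    hc_meas hc_bd (α := blk) hblk_meas hblkB (N := 2 * S + 1) (M := rr + n + b' + 2 + 1) (by omega)
  have hXb_app : ∀ u u', (∫ v : Fin rr → GaugeConfig 3 (2 * S + 1) G, ∫ γs : Fin (rr + 1) → Site 3 (2 * S + 1) → G,
        blk (Fin.cons u (Fin.snoc v u')) γs * ∏ i : Fin (rr + 1),
          (Real.exp (-(β * wilsonAction r.ρ ((Fin.cons u (Fin.snoc v u') : Fin (rr + 2) → GaugeConfig 3 (2 * S + 1) G) (Fin.castSucc i)) / 2)) *
            Real.exp (-(β * sliceTemporalAction r.ρ ((Fin.cons u (Fin.snoc v u') : Fin (rr + 2) → GaugeConfig 3 (2 * S + 1) G) (Fin.castSucc i)) (γs i)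
              ((Fin.cons u (Fin.snoc v u') : Fin (rr + 2) → GaugeConfig 3 (2 * S + 1) G) (Fin.succ i)))) *
            Real.exp (-(β * wilsonAction r.ρ ((Fin.cons u (Fin.snoc v u') : Fin (rr + 2) → GaugeConfig 3 (2 * S + 1) G) (Fin.succ i)) / 2)))
        ∂(Measure.pi fun _ => Measure.pi fun _ : Site 3 (2 * S + 1) => haarProbability G)
        ∂(Measure.pi fun _ => Measure.pi fun _ : Edge 3 (2 * S + 1) => haarProbability G)) = Xb u u' := fun u u' => by
    rw [hXb_def]
  simp only [hKc, hXb_app] at h1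
  have h0' : ∫ p : (ZMod (2 * S + 1) → GaugeConfig 3 (2 * S + 1) G) × (ZMod (2 * S + 1) → Site 3 (2 * S + 1) → G),
      ∏ t : ZMod (2 * S + 1), (Real.exp (-(β * wilsonAction r.ρ (p.1 t) / 2)) *
        Real.exp (-(β * sliceTemporalAction r.ρ (p.1 t) (p.2 t) (p.1 (t + 1)))) * Real.exp (-(β * wilsonAction r.ρ (p.1 (t + 1)) / 2)))
        ∂((Measure.pi fun _ : ZMod (2 * S + 1) => Measure.pi fun _ : Edge 3 (2 * S + 1) => haarProbability G).prod
          (Measure.pi fun _ : ZMod (2 * S + 1) => Measure.pi fun _ : Site 3 (2 * S + 1) => haarProbability G)) =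
      ∫ V : Fin (2 * rr + n + b' + 3 + 2) → GaugeConfig 3 (2 * S + 1) G, ∏ t, wilsonSliceKernel r.ρ β (V t) (V (t + 1))
        ∂(Measure.pi fun _ => Measure.pi fun _ : Edge 3 (2 * S + 1) => haarProbability G) := h0
  -- the two-block cycles (slab_cyclic_two_succ): reflected block at `0 … rr+1`, block of `Y_a` at `rr+a+2 …`
  have h2 : ∀ (a b₂ : ℕ), 2 * S + 1 = 2 * rr + a + b₂ + 4 + 1 →
      ∫ q : (ZMod (2 * S + 1) → GaugeConfig 3 (2 * S + 1) G) × (ZMod (2 * S + 1) → Site 3 (2 * S + 1) → G),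
        blkR (fun i : Fin (rr + 2) => q.1 ((i : ℕ) : ZMod (2 * S + 1))) (fun i : Fin (rr + 1) => q.2 ((i : ℕ) : ZMod (2 * S + 1))) *
          blk (fun i : Fin (rr + 2) => q.1 ((rr + a + 2 + (i : ℕ) : ℕ) : ZMod (2 * S + 1)))
            (fun i : Fin (rr + 1) => q.2 ((rr + a + 2 + (i : ℕ) : ℕ) : ZMod (2 * S + 1))) *
          ∏ t : ZMod (2 * S + 1), (Real.exp (-(β * wilsonAction r.ρ (q.1 t) / 2)) *
            Real.exp (-(β * sliceTemporalAction r.ρ (q.1 t) (q.2 t) (q.1 (t + 1)))) * Real.exp (-(β * wilsonAction r.ρ (q.1 (t + 1)) / 2)))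
        ∂((Measure.pi fun _ : ZMod (2 * S + 1) => Measure.pi fun _ : Edge 3 (2 * S + 1) => haarProbability G).prod
          (Measure.pi fun _ : ZMod (2 * S + 1) => Measure.pi fun _ : Site 3 (2 * S + 1) => haarProbability G)) =
      ∫ V : Fin (1 + (a + 1 + (b₂ + 1 + 1)) + 1) → GaugeConfig 3 (2 * S + 1) G,
          ∏ t : Fin (1 + (a + 1 + (b₂ + 1 + 1)) + 1),
            (fun s : ℕ => if s = 0 then (fun u u' => Xb u' u) else if s = a + 1 + 1 then Xb
              else fun x x' => wilsonSliceKernel r.ρ β x x') (t : ℕ) (V t) (V (t + 1))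
        ∂(Measure.pi fun _ => Measure.pi fun _ : Edge 3 (2 * S + 1) => haarProbability G) := by
    intro a b₂ hNa
    have h := slab_cyclic_two_succ (μ := Measure.pi fun _ : Edge 3 (2 * S + 1) => haarProbability G)
      (ν := Measure.pi fun _ : Site 3 (2 * S + 1) => haarProbability G)
      (c := fun x γ x' => Real.exp (-(β * wilsonAction r.ρ x / 2)) * Real.exp (-(β * sliceTemporalAction r.ρ x γ x')) * Real.exp (-(β * wilsonAction r.ρ x' / 2)))
      hc_meas hc_bd (α := blkR) (β := blk) hblkR_meas hblk_meas hblkRB hblkB (N := 2 * S + 1) (a := a) (b' := b₂) hNa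
    simp only [hKc] at h
    rw [hXbR, ← hXb_def] at h
    exact h
  -- the numerators in the rotated coordinates
  have hnum2 : ∀ a : ℕ,
      ∫ p : (ZMod (2 * S + 1) → GaugeConfig 3 (2 * S + 1) G) × (ZMod (2 * S + 1) → Site 3 (2 * S + 1) → G),
        (Y (torusLift (2 * S + 1) (GaugeConfig.timeReflect (asm p))) * Y (configShift (-Pi.single 0 (a : ℤ)) (torusLift (2 * S + 1) (asm p)))) *
          ∏ t : ZMod (2 * S + 1), (Real.exp (-(β * wilsonAction r.ρ (p.1 t) / 2)) *
            Real.exp (-(β * sliceTemporalAction r.ρ (p.1 t) (p.2 t) (p.1 (t + 1)))) * Real.exp (-(β * wilsonAction r.ρ (p.1 (t + 1)) / 2)))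
        ∂((Measure.pi fun _ : ZMod (2 * S + 1) => Measure.pi fun _ : Edge 3 (2 * S + 1) => haarProbability G).prod
          (Measure.pi fun _ : ZMod (2 * S + 1) => Measure.pi fun _ : Site 3 (2 * S + 1) => haarProbability G)) =
      ∫ q : (ZMod (2 * S + 1) → GaugeConfig 3 (2 * S + 1) G) × (ZMod (2 * S + 1) → Site 3 (2 * S + 1) → G),
        blkR (fun i : Fin (rr + 2) => q.1 ((i : ℕ) : ZMod (2 * S + 1))) (fun i : Fin (rr + 1) => q.2 ((i : ℕ) : ZMod (2 * S + 1))) *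
          blk (fun i : Fin (rr + 2) => q.1 ((rr + a + 2 + (i : ℕ) : ℕ) : ZMod (2 * S + 1)))
            (fun i : Fin (rr + 1) => q.2 ((rr + a + 2 + (i : ℕ) : ℕ) : ZMod (2 * S + 1))) *
          ∏ t : ZMod (2 * S + 1), (Real.exp (-(β * wilsonAction r.ρ (q.1 t) / 2)) *
            Real.exp (-(β * sliceTemporalAction r.ρ (q.1 t) (q.2 t) (q.1 (t + 1)))) * Real.exp (-(β * wilsonAction r.ρ (q.1 (t + 1)) / 2)))
        ∂((Measure.pi fun _ : ZMod (2 * S + 1) => Measure.pi fun _ : Edge 3 (2 * S + 1) => haarProbability G).prod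
          (Measure.pi fun _ : ZMod (2 * S + 1) => Measure.pi fun _ : Site 3 (2 * S + 1) => haarProbability G)) := by
    intro a
    rw [← hrotInt c₀ (fun q => blkR (fun i : Fin (rr + 2) => q.1 ((i : ℕ) : ZMod (2 * S + 1))) (fun i : Fin (rr + 1) => q.2 ((i : ℕ) : ZMod (2 * S + 1))) *
          blk (fun i : Fin (rr + 2) => q.1 ((rr + a + 2 + (i : ℕ) : ℕ) : ZMod (2 * S + 1)))
            (fun i : Fin (rr + 1) => q.2 ((rr + a + 2 + (i : ℕ) : ℕ) : ZMod (2 * S + 1))) *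
          ∏ t : ZMod (2 * S + 1), (Real.exp (-(β * wilsonAction r.ρ (q.1 t) / 2)) *
            Real.exp (-(β * sliceTemporalAction r.ρ (q.1 t) (q.2 t) (q.1 (t + 1)))) * Real.exp (-(β * wilsonAction r.ρ (q.1 (t + 1)) / 2))))]
    refine integral_congr_ae (ae_of_all _ fun p => ?_)
    dsimp only
    rw [hcylR p, hcylT a p, hprod_rot c₀ p]
  have hnum1 :
      ∫ p : (ZMod (2 * S + 1) → GaugeConfig 3 (2 * S + 1) G) × (ZMod (2 * S + 1) → Site 3 (2 * S + 1) → G),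
        Y (torusLift (2 * S + 1) (asm p)) *
          ∏ t : ZMod (2 * S + 1), (Real.exp (-(β * wilsonAction r.ρ (p.1 t) / 2)) *
            Real.exp (-(β * sliceTemporalAction r.ρ (p.1 t) (p.2 t) (p.1 (t + 1)))) * Real.exp (-(β * wilsonAction r.ρ (p.1 (t + 1)) / 2)))
        ∂((Measure.pi fun _ : ZMod (2 * S + 1) => Measure.pi fun _ : Edge 3 (2 * S + 1) => haarProbability G).prod
          (Measure.pi fun _ : ZMod (2 * S + 1) => Measure.pi fun _ : Site 3 (2 * S + 1) => haarProbability G)) =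
      ∫ q : (ZMod (2 * S + 1) → GaugeConfig 3 (2 * S + 1) G) × (ZMod (2 * S + 1) → Site 3 (2 * S + 1) → G),
        blk (fun i : Fin (rr + 2) => q.1 ((i : ℕ) : ZMod (2 * S + 1))) (fun i : Fin (rr + 1) => q.2 ((i : ℕ) : ZMod (2 * S + 1))) *
          ∏ t : ZMod (2 * S + 1), (Real.exp (-(β * wilsonAction r.ρ (q.1 t) / 2)) *
            Real.exp (-(β * sliceTemporalAction r.ρ (q.1 t) (q.2 t) (q.1 (t + 1)))) * Real.exp (-(β * wilsonAction r.ρ (q.1 (t + 1)) / 2)))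
        ∂((Measure.pi fun _ : ZMod (2 * S + 1) => Measure.pi fun _ : Edge 3 (2 * S + 1) => haarProbability G).prod
          (Measure.pi fun _ : ZMod (2 * S + 1) => Measure.pi fun _ : Site 3 (2 * S + 1) => haarProbability G)) := by
    rw [← hrotInt 1 (fun q => blk (fun i : Fin (rr + 2) => q.1 ((i : ℕ) : ZMod (2 * S + 1))) (fun i : Fin (rr + 1) => q.2 ((i : ℕ) : ZMod (2 * S + 1))) *
          ∏ t : ZMod (2 * S + 1), (Real.exp (-(β * wilsonAction r.ρ (q.1 t) / 2)) *
            Real.exp (-(β * sliceTemporalAction r.ρ (q.1 t) (q.2 t) (q.1 (t + 1)))) * Real.exp (-(β * wilsonAction r.ρ (q.1 (t + 1)) / 2))))]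
    refine integral_congr_ae (ae_of_all _ fun p => ?_)
    dsimp only
    rw [hcyl1 p, hprod_rot 1 p]
  -- assembling the three ratios
  have hmPair : ∀ a : ℕ, Measurable fun U : GaugeConfig 4 (2 * S + 1) G =>
      Y (torusLift (2 * S + 1) (GaugeConfig.timeReflect U)) * Y (configShift (-Pi.single 0 (a : ℤ)) (torusLift (2 * S + 1) U)) :=
    fun a => hmΘY.mul (hmYn a)
  refine ⟨Xb, hXb_sm, hXb_bd, hXb_dom, ?_, ?_, ?_⟩
  · rw [hE _ (hmPair n), hnum2 n, h2 n b' hN, h0']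
  · have hNa : 2 * S + 1 = 2 * rr + 0 + (n + b') + 4 + 1 := by omega
    have hconv : ∫ U, Y (torusLift (2 * S + 1) (GaugeConfig.timeReflect U)) * Y (torusLift (2 * S + 1) U)
          ∂(wilsonMeasure r.ρ β : Measure (GaugeConfig 4 (2 * S + 1) G)) =
        ∫ U, Y (torusLift (2 * S + 1) (GaugeConfig.timeReflect U)) * Y (configShift (-Pi.single 0 ((0 : ℕ) : ℤ)) (torusLift (2 * S + 1) U))
          ∂(wilsonMeasure r.ρ β : Measure (GaugeConfig 4 (2 * S + 1) G)) := by
      simp only [Nat.cast_zero, Pi.single_zero, neg_zero, hshift0]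
    rw [hconv, hE _ (hmPair 0), hnum2 0, h2 0 (n + b') hNa, h0']
  · rw [hE _ hmY, hnum1, h1, h0']

end Summit.QuantumFields.YangMills.Theorems.WeakCouplingHypercubicLimit.TraceNormColdPressure

end
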